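import Literature.AnabelianGeometry.EtaleTheta.ThetaCoversTemperedOfSetting
import Literature.AnabelianGeometry.EtaleTheta.Discharge.Sec2BarDeltaBridgeLe
import Literature.AnabelianGeometry.EtaleTheta.XuuCocycleNormal
import HarnessLib

/-!
# [EtTh] §2 at the §1 model: «`K` contains a primitive `l`-th root of unity» ⇒ `HasMuL` — `Π_C` acts
# trivially on `Δ̄_Θ` for the assembled cover (proof-only companion; the antecedent of Rmk. 2.6.1 / Cor. 2.9
# at the model made print-shaped), with the REVERSE tempered ↔ profinite bridge `Δ̄_Θ-preimage = cl(toHat(·))`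

Mochizuki, *The étale theta function and its Frobenioid-theoretic manifestations*, Publ. RIMS **45**
(2009), §2: Rmk. 2.6.1 p. 40 ("Suppose, for simplicity, that `K` contains a primitive `l`-th root of unity.
Then …"), Cor. 2.9 p. 43, Def. 2.1 preamble p. 35 ("`Δ̄_Θ ≅ (ℤ/lℤ)(1)`"), §1 p. 12 ("`Δ_Θ ≅ Ẑ(1)`")
[cite: MochizukiEtTh2009, Rmk 2.6.1 p.40].

Cell abc-iut, layer L2, seat abc-iut-L2-d3 (gen 5); W3-L2-02 residue. PROOF-ONLY (0 defs, no new `Prop` fact).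
abc-iut-L2-t2's typed Rmk. 2.6.1 / Cor. 2.9 (`TemperedCoverData.Rmk261`, `Cor29_card`, …) carry print's
hypothesis «`μ_l ⊆ K`» group-theoretically as the ANTECEDENT `T.HasMuL := ∀ c ∈ Π_C, ∀ t ∈ Δ̄_Θ-preimage,
[c,t] ∈ Ker` ("all of `Π_C` acts trivially on `Δ̄_Θ ≅ (ℤ/lℤ)(1)`"); at the setting-born cover
`MuTwoSetting.CLevelData.temperedCoverData` (ThetaCoversTemperedOfSetting) nobody had derived it from the
field-theoretic statement. This file does, in four steps:

* (1) TEMPERED: `ThetaSetting.commutator_mem_barKerTp_of_trivial_action` — if `Π^tp_X` acts trivially on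
  `Δ_Θ/l·Δ_Θ` (the shape abc-iut-L2-t7 proves in `XuuCocycleNormal.conj_mul_inv_mem_lDeltaTheta_of_muN_subset`
  from `μ_l ⊆ K` and abc-iut-L2-t8's cyclotome identification `CyclotomeMod 1 l` = «`Δ_Θ/l ≅ μ_l`,
  `G_K`-equivariantly», p. 12/p. 46), then `[σ, t] ∈ Ker(Δ^tp_X ↠ Δ̄_X)` for all `σ ∈ Π^tp_X`, `t` in the tempered
  `Δ̄_Θ`-preimage (`Δ_Θ` is central in `(Δ^tp_X)^Θ` and `⟨l-th powers⟩` is normal; abc-iut-L2-d3 gen 4's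
  `BarDeltaOfSetting`);
* (2) BRIDGE, reverse direction (gen 4's `Sec2BarDeltaBridgeLe` had only `toHat(barThetaTp) ≤ barThetaHat`):
  `ThetaSetting.barThetaHat_le_closure_map_barThetaTp` / `barThetaHat_eq_closure_map_barThetaTp` — the
  profinite `Δ̄_Θ`-preimage IS the closure of the image of the tempered one (commutators and `l`-th powers of
  the dense `toHat(Δ^tp_X) ⊆ Δ_X` are dense in those of `Δ_X`);
* (3) PROFINITE `Π_X`: `ThetaSetting.commutator_mem_barKerHat_of_trivial_action` — by density of `toHat(Π^tp_X)`
  and (2), continuity of `(c,t) ↦ [c,t]`, closedness of `barKerHat`;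
* (4) `Π_C`: **`MuTwoSetting.CLevelData.temperedCoverData_hasMuL`** — `T.HasMuL` for the assembled cover:
  inside `Π_X` by (3) transported along `incl` (`barTheta_eq_map`, `barKer_eq_map`); an element outside `Π_X`
  is `c₁·y` with `c₁ ∈ Δ_C ∖ Π_X` acting trivially on `Δ̄_Θ` (P-C4 ⇒ `inv_theta_of_inv_ell`) and `y ∈ Π_X`;
  **`temperedCoverData_hasMuL_of_muL`** — the same from «`μ_l ⊆ K`» + `CyclotomeMod 1 l` via abc-iut-L2-t7.
  Consumers: `rmk261_ofSetting … (temperedCoverData_hasMuL_of_muL …)` (abc-iut-f-144) and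
  `temperedCoverData_cor29_card′ … (temperedCoverData_hasMuL_of_muL …)` (this seat) now read exactly as
  print: "Suppose `K ⊇ μ_l`. Then `Aut_K(X̲̲) = μ_l × {±1}`, …".

HONEST FRAMING: the cyclotome identification `CyclotomeMod 1 l` is DATA quoting print (inhabited at the
χ-model by abc-iut-L2-t8), not asserted for an actual curve; nothing asserts that a `MuTwoSetting` exists;
[EtTh] is refereed; no side is taken on [IUTchIII] Cor. 3.12; typed ≠ proved elsewhere.
-/

namespace Literature.AnabelianGeometry.EtaleTheta

open Literature.AnabelianGeometry.SemiGraphs ThetaCovers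
open _root_.Topology

/-! ### (1) Tempered: trivial action on `Δ_Θ/l·Δ_Θ` ⇒ `[Π^tp_X, Δ̄_Θ-preimage] ⊆ Ker` -/

namespace ThetaSetting

variable {p : ℕ} [Fact p.Prime] (D : ThetaSetting p) (l : ℕ)

/-- **`[σ, t] ∈ Ker(Δ^tp_X ↠ Δ̄_X)`** for `σ ∈ Π^tp_X` and `t` in the tempered `Δ̄_Θ`-preimage, when `Π^tp_X`
acts trivially on `Δ_Θ/l·Δ_Θ`: writing `θ(t) = q·a` (`q ∈ ⟨l-th powers⟩`, `a ∈ Δ_Θ`),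
`θ[σ,t] = (σ̄qσ̄⁻¹)·(σ̄aσ̄⁻¹a⁻¹)·(aq⁻¹a⁻¹)` with every factor in `⟨l-th powers⟩` (normality, the hypothesis,
`l·Δ_Θ ⊆ ⟨l-th powers⟩`, centrality of `Δ_Θ`). [cite: MochizukiEtTh2009, Rmk 2.6.1 p.40] -/
theorem commutator_mem_barKerTp_of_trivial_action
    (hμ : ∀ (σ : D.PiTemp) (a : D.GtpTheta), a ∈ D.DeltaTheta →
      D.toTheta σ * a * (D.toTheta σ)⁻¹ * a⁻¹ ∈ D.lDeltaTheta l)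
    (σ : D.PiTemp) {t : D.PiTemp} (ht : t ∈ D.barThetaTp l) :
    σ * t * σ⁻¹ * t⁻¹ ∈ D.barKerTp l := by
  haveI : D.DeltaTemp.Normal := MonoidHom.normal_ker D.aug.toMonoidHom
  haveI := D.powTheta_normal l
  obtain ⟨htΔ, htP⟩ := (D.mem_barThetaTp_iff l).1 ht
  obtain ⟨q, hq, a, ha, hqa⟩ := Subgroup.mem_sup_of_normal_left.1 htP
  refine (D.mem_barKerTp_iff l).2 ⟨?_, ?_⟩
  · exact mul_mem (Subgroup.Normal.conj_mem inferInstance t htΔ σ) (inv_mem htΔ)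
  · have hcomm : a⁻¹ * q⁻¹ = q⁻¹ * a⁻¹ :=
      D.deltaTheta_comm_dtpTheta (inv_mem ha) (inv_mem (D.powTheta_le_dtpTheta l hq))
    rw [map_mul, map_mul, map_mul, map_inv, map_inv, ← hqa, mul_inv_rev, hcomm]
    have key : D.toTheta σ * (q * a) * (D.toTheta σ)⁻¹ * (q⁻¹ * a⁻¹) =
        (D.toTheta σ * q * (D.toTheta σ)⁻¹) *
          ((D.toTheta σ * a * (D.toTheta σ)⁻¹ * a⁻¹) * (a * q⁻¹ * a⁻¹)) := by group
    rw [key]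
    refine mul_mem (Subgroup.Normal.conj_mem inferInstance q hq _) (mul_mem ?_ ?_)
    · exact D.lDeltaTheta_le_powTheta l (hμ σ a ha)
    · exact Subgroup.Normal.conj_mem inferInstance q⁻¹ (inv_mem hq) a

/-! ### (2) Bridge: the profinite `Δ̄_Θ`-preimage is the closure of the tempered one -/

/-- `Δ_X = cl(toHat(Δ^tp_X))` as sets. [cite: MochizukiEtTh2009, §1 p.12] -/
theorem coe_deltaHat_eq_closure :
    (D.DeltaHat : Set D.PiHat) = closure (D.toHat '' (D.DeltaTemp : Set D.PiTemp)) := by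
  show ((TemperedCurve.DeltaHat D.toTemperedCurve : Subgroup D.PiHat) : Set D.PiHat) = _
  rw [TemperedCurve.DeltaHat, Subgroup.topologicalClosure_coe, Subgroup.coe_map]
  rfl

/-- **`barThetaHat ≤ cl(toHat(barThetaTp))`**: the generators of the profinite `Δ̄_Θ`-preimage — commutators
`[a,b]` and `l`-th powers `a^l` of elements of `Δ_X = cl(toHat(Δ^tp_X))` — are limits of images of tempered
commutators / `l`-th powers, which lie in the tempered `Δ̄_Θ`-preimage.
[cite: MochizukiEtTh2009, Def 2.1 p.35] -/
theorem barThetaHat_le_closure_map_barThetaTp :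
    D.barThetaHat l ≤ ((D.barThetaTp l).map D.toHat.toMonoidHom).topologicalClosure := by
  set C := ((D.barThetaTp l).map D.toHat.toMonoidHom).topologicalClosure with hC
  have hCcl : IsClosed (C : Set D.PiHat) := Subgroup.isClosed_topologicalClosure _
  set A : Set D.PiHat := D.toHat '' (D.DeltaTemp : Set D.PiTemp) with hA
  have hΔ : (D.DeltaHat : Set D.PiHat) = closure A := D.coe_deltaHat_eq_closure
  -- commutators
  have h1 : ⁅D.DeltaHat, D.DeltaHat⁆ ≤ C := by
    rw [Subgroup.commutator_le]
    intro a ha b hb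
    have hF : Continuous fun x : D.PiHat × D.PiHat => x.1 * x.2 * x.1⁻¹ * x.2⁻¹ := by fun_prop
    have hab : (a, b) ∈ closure (A ×ˢ A) := by
      rw [closure_prod_eq, ← hΔ]; exact ⟨ha, hb⟩
    have himg : (fun x : D.PiHat × D.PiHat => x.1 * x.2 * x.1⁻¹ * x.2⁻¹) '' (A ×ˢ A) ⊆ (C : Set D.PiHat) := by
      rintro _ ⟨⟨_, _⟩, ⟨⟨x, hx, rfl⟩, ⟨y, hy, rfl⟩⟩, rfl⟩
      refine Subgroup.le_topologicalClosure _ ⟨x * y * x⁻¹ * y⁻¹, D.commutator_mem_barThetaTp l hx hy, ?_⟩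
      rw [map_mul, map_mul, map_mul, map_inv, map_inv]
      rfl
    have := image_closure_subset_closure_image hF ⟨(a, b), hab, rfl⟩
    exact hCcl.closure_subset_iff.2 himg this
  -- `l`-th powers
  have h2 : D.deltaHatPow l ≤ C := by
    rw [D.deltaHatPow_eq_closure l, Subgroup.closure_le]
    rintro _ ⟨y, hy, rfl⟩
    have hG : Continuous fun x : D.PiHat => x ^ l := continuous_pow l
    have hy' : y ∈ closure A := by rw [← hΔ]; exact hy
    have himg : (fun x : D.PiHat => x ^ l) '' A ⊆ (C : Set D.PiHat) := by
      rintro _ ⟨_, ⟨x, hx, rfl⟩, rfl⟩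
      refine Subgroup.le_topologicalClosure _ ⟨x ^ l, D.barKerTp_le_barThetaTp l (D.pow_mem_barKerTp l hx), ?_⟩
      rw [map_pow]
      rfl
    have := image_closure_subset_closure_image hG ⟨y, hy', rfl⟩
    exact hCcl.closure_subset_iff.2 himg this
  exact Subgroup.topologicalClosure_minimal _ (sup_le h1 h2) hCcl

/-- **`barThetaHat = cl(toHat(barThetaTp))`**: the profinite `Δ̄_Θ`-preimage IS the closure of the image of the
tempered one (with gen 4's `barThetaTp_le_comap_barThetaHat`). [cite: MochizukiEtTh2009, Def 2.1 p.35] -/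
theorem barThetaHat_eq_closure_map_barThetaTp :
    D.barThetaHat l = ((D.barThetaTp l).map D.toHat.toMonoidHom).topologicalClosure := by
  refine le_antisymm (D.barThetaHat_le_closure_map_barThetaTp l)
    (Subgroup.topologicalClosure_minimal _ ?_ (D.isClosed_barThetaHat l))
  rintro _ ⟨x, hx, rfl⟩
  exact D.barThetaTp_le_comap_barThetaHat l hx

/-! ### (3) Profinite `Π_X`: `[Π_X, Δ̄_Θ-preimage] ⊆ Ker` -/

/-- **`[c, t] ∈ barKerHat`** for every `c ∈ Π_X` and `t` in the profinite `Δ̄_Θ`-preimage, when `Π^tp_X` acts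
trivially on `Δ_Θ/l·Δ_Θ` (density of `toHat(Π^tp_X)` in `Π_X` and of `toHat(barThetaTp)` in `barThetaHat`,
continuity of the commutator, closedness of `barKerHat`). [cite: MochizukiEtTh2009, Rmk 2.6.1 p.40] -/
theorem commutator_mem_barKerHat_of_trivial_action
    (hμ : ∀ (σ : D.PiTemp) (a : D.GtpTheta), a ∈ D.DeltaTheta →
      D.toTheta σ * a * (D.toTheta σ)⁻¹ * a⁻¹ ∈ D.lDeltaTheta l)
    (c : D.PiHat) {t : D.PiHat} (ht : t ∈ D.barThetaHat l) : c * t * c⁻¹ * t⁻¹ ∈ D.barKerHat l := by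
  have hF : Continuous fun x : D.PiHat × D.PiHat => x.1 * x.2 * x.1⁻¹ * x.2⁻¹ := by fun_prop
  set A : Set D.PiHat := Set.range D.toHat with hA
  set B : Set D.PiHat := D.toHat '' (D.barThetaTp l : Set D.PiTemp) with hB
  have hcA : c ∈ closure A := by
    rw [D.isProfiniteCompletion_toHat.denseRange.closure_range]; exact Set.mem_univ _
  have htB : t ∈ closure B := by
    have := D.barThetaHat_le_closure_map_barThetaTp l ht
    rw [← SetLike.mem_coe, Subgroup.topologicalClosure_coe, Subgroup.coe_map] at this
    exact this
  have hct : (c, t) ∈ closure (A ×ˢ B) := by rw [closure_prod_eq]; exact ⟨hcA, htB⟩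
  have himg : (fun x : D.PiHat × D.PiHat => x.1 * x.2 * x.1⁻¹ * x.2⁻¹) '' (A ×ˢ B) ⊆
      (D.barKerHat l : Set D.PiHat) := by
    rintro _ ⟨⟨_, _⟩, ⟨⟨σ, rfl⟩, ⟨t₀, ht₀, rfl⟩⟩, rfl⟩
    have h := D.barKerTp_le_comap_barKerHat l (D.commutator_mem_barKerTp_of_trivial_action l hμ σ ht₀)
    rw [Subgroup.mem_comap, map_mul, map_mul, map_mul, map_inv, map_inv] at h
    exact h
  have := image_closure_subset_closure_image hF ⟨(c, t), hct, rfl⟩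
  exact (D.isClosed_barKerHat l).closure_subset_iff.2 himg this

end ThetaSetting

/-! ### (4) `Π_C`: `HasMuL` for the assembled cover -/

namespace MuTwoSetting.CLevelData

variable {p : ℕ} [Fact p.Prime] {M : MuTwoSetting p}
variable {PC : Type} [Group PC] [TopologicalSpace PC] [IsTopologicalGroup PC] [T2Space PC]

/-- **`HasMuL` at the model from the trivial action of `Π^tp_X` on `Δ_Θ/l·Δ_Θ`**: all of `Π_C` acts trivially
on `Δ̄_Θ` for `e.temperedCoverData …` — inside `Π_X` by (3) transported along `incl`; outside, an element is
`c₁·y` with `c₁ ∈ Δ_C ∖ Π_X` acting trivially on `Δ̄_Θ` (P-C4 `hιell` ⇒ `inv_theta_of_inv_ell`) and `y ∈ Π_X`.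
[cite: MochizukiEtTh2009, Rmk 2.6.1 p.40] -/
theorem temperedCoverData_hasMuL (e : M.CLevelData) (ιC : M.GtpC →ₜ* PC)
    (hιC : IsProfiniteCompletion ιC) (hinj : Function.Injective ιC) (op : M.toThetaSetting.OncePuncturedData)
    {l : ℕ} (hodd : Odd l) {x : M.Pt} (hx : M.IsCusp x)
    (hIx : ((e.piCDataOf ιC hιC).Dx x ⊓ (e.piCDataOf ιC hιC).augGK.ker) ⊔ (e.piCDataOf ιC hιC).barKer l =
      (e.piCDataOf ιC hιC).barTheta l)
    (hιell : ∀ c ∈ (e.piCDataOf ιC hιC).augGK.ker, c ∉ (e.piCDataOf ιC hιC).PiX →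
      ∀ d ∈ (e.piCDataOf ιC hιC).PiX ⊓ (e.piCDataOf ιC hιC).augGK.ker,
        c * d * c⁻¹ * d ∈ (e.piCDataOf ιC hιC).barTheta l)
    (hN : ((M.GtpXu l).map M.inclX).Normal) (hY : (M.GtpY.map M.inclX).Normal) {S : Subgroup PC}
    (hS : ((e.piCDataOf ιC hιC).coverDataAx l op hx hodd hIx hιell
        ((e.piCDataOf ιC hιC).inv_theta_of_inv_ell l op hιell)).toCoverData.IsSplitting S)
    (hSc : IsClosed (S : Set PC))
    (hμ : ∀ (σ : M.PiTemp) (a : M.GtpTheta), a ∈ M.DeltaTheta →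
      M.toTheta σ * a * (M.toTheta σ)⁻¹ * a⁻¹ ∈ M.lDeltaTheta l) :
    (e.temperedCoverData ιC hιC hinj op hodd hx hIx hιell hN hY hS hSc).HasMuL := by
  set I := e.piCDataOf ιC hιC with hI
  haveI : (I.barTheta l).Normal := I.barTheta_normal l op
  -- inside `Π_X`
  have hX : ∀ c ∈ I.PiX, ∀ t ∈ I.barTheta l, c * t * c⁻¹ * t⁻¹ ∈ I.barKer l := by
    rintro _ ⟨ĉ, rfl⟩ t ht
    rw [I.barTheta_eq_map l op] at ht
    obtain ⟨t₀, ht₀, rfl⟩ := ht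
    rw [I.barKer_eq_map l op]
    refine ⟨ĉ * t₀ * ĉ⁻¹ * t₀⁻¹,
      M.toThetaSetting.commutator_mem_barKerHat_of_trivial_action l hμ ĉ ht₀, ?_⟩
    rw [map_mul, map_mul, map_mul, map_inv, map_inv]
  show ∀ c : PC, ∀ t ∈ I.barTheta l, c * t * c⁻¹ * t⁻¹ ∈ I.barKer l
  intro c t ht
  by_cases hc : c ∈ I.PiX
  · exact hX c hc t ht
  · -- `c = c₁ · y`, `c₁ ∈ Δ_C ∖ Π_X`, `y ∈ Π_X`
    obtain ⟨⟨y, hy⟩, hya⟩ := I.augGK_PiX_surjective (I.augGK c)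
    have hya : I.augGK y = I.augGK c := hya
    have hc₁K : c * y⁻¹ ∈ I.augGK.ker := by
      rw [MonoidHom.mem_ker, map_mul, map_inv, hya, mul_inv_cancel]
    have hc₁X : c * y⁻¹ ∉ I.PiX := fun h => hc (by
      have := Subgroup.mul_mem _ h hy
      rwa [inv_mul_cancel_right] at this)
    have ht' : y * t * y⁻¹ ∈ I.barTheta l := Subgroup.Normal.conj_mem inferInstance t ht y
    have h₁ := I.inv_theta_of_inv_ell l op hιell (c * y⁻¹) hc₁K hc₁X _ ht'
    have h₂ := hX y hy t ht
    have key : c * t * c⁻¹ * t⁻¹ =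
        (c * y⁻¹ * (y * t * y⁻¹) * (c * y⁻¹)⁻¹ * (y * t * y⁻¹)⁻¹) * (y * t * y⁻¹ * t⁻¹) := by group
    rw [key]
    exact mul_mem h₁ h₂

/-- **«Suppose that `K` contains a primitive `l`-th root of unity» ⇒ `HasMuL`** at the model: with
abc-iut-L2-t8's cyclotome identification `μ : CyclotomeMod 1 l` ("`Δ_Θ/l ≅ μ_l`", `G_K`-equivariant; p. 12 /
p. 46) and `μ_l ⊆ K`, all of `Π_C` acts trivially on `Δ̄_Θ` (abc-iut-L2-t7's
`conj_mul_inv_mem_lDeltaTheta_of_muN_subset` + `temperedCoverData_hasMuL`). Feeding it to abc-iut-f-144's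
`rmk261_ofSetting` / this seat's `temperedCoverData_cor29_card′` yields Rmk. 2.6.1 / Cor. 2.9 at the model
under print's own hypothesis. [cite: MochizukiEtTh2009, Rmk 2.6.1 p.40] -/
theorem temperedCoverData_hasMuL_of_muL (e : M.CLevelData) (ιC : M.GtpC →ₜ* PC)
    (hιC : IsProfiniteCompletion ιC) (hinj : Function.Injective ιC) (op : M.toThetaSetting.OncePuncturedData)
    {l : ℕ+} (hodd : Odd (l : ℕ)) {x : M.Pt} (hx : M.IsCusp x)
    (hIx : ((e.piCDataOf ιC hιC).Dx x ⊓ (e.piCDataOf ιC hιC).augGK.ker) ⊔ (e.piCDataOf ιC hιC).barKer l =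
      (e.piCDataOf ιC hιC).barTheta l)
    (hιell : ∀ c ∈ (e.piCDataOf ιC hιC).augGK.ker, c ∉ (e.piCDataOf ιC hιC).PiX →
      ∀ d ∈ (e.piCDataOf ιC hιC).PiX ⊓ (e.piCDataOf ιC hιC).augGK.ker,
        c * d * c⁻¹ * d ∈ (e.piCDataOf ιC hιC).barTheta l)
    (hN : ((M.GtpXu l).map M.inclX).Normal) (hY : (M.GtpY.map M.inclX).Normal) {S : Subgroup PC}
    (hS : ((e.piCDataOf ιC hιC).coverDataAx l op hx hodd hIx hιell
        ((e.piCDataOf ιC hιC).inv_theta_of_inv_ell l op hιell)).toCoverData.IsSplitting S)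
    (hSc : IsClosed (S : Set PC)) (μ : M.toThetaSetting.CyclotomeMod 1 l)
    (hμK : ∀ ζ : MuN p l, (((ζ : (PadicAlgCl p)ˣ) : PadicAlgCl p)) ∈ M.K) :
    (e.temperedCoverData ιC hιC hinj op hodd hx hIx hιell hN hY hS hSc).HasMuL :=
  temperedCoverData_hasMuL e ιC hιC hinj op hodd hx hIx hιell hN hY hS hSc fun σ a ha =>
    M.toThetaSetting.conj_mul_inv_mem_lDeltaTheta_of_muN_subset μ hμK σ ⟨a, ha⟩

end MuTwoSetting.CLevelData

end Literature.AnabelianGeometry.EtaleTheta
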